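import Literature.AnabelianGeometry.SemiGraphs.ProfiniteSemiGraphHomRestrict
import Literature.AnabelianGeometry.SemiGraphs.NestedRestriction
import HarnessLib

/-!
# Nested restriction in the tempered presentation: `(𝒢_K)_{ℍ ∩ K} ≅ (𝒢_ℍ)_{K ∩ ℍ}` and
# `(−)|_K ⋙ (−)|_{ℍ∩K} ≅ (−)|_ℍ ⋙ (−)|_{K∩ℍ}` on `B^cov` / `B^temp` — DEFINITIONS

Mochizuki, *Semi-graphs of anabelioids*, Publ. RIMS **42** (2006), §1 p. 12 (sub-semi-graphs), Def. 2.1 p. 24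
("the semi-graph of anabelioids `𝒢_ℍ` obtained by restricting `𝒢` to `ℍ`", "`(𝒢_ℍ)_c := 𝒢_c`"), Def. 3.5 (ii)
p. 37 (the categories `B^cov(𝒢) ⊇ B^temp(𝒢)`), Prop. 3.6 (iv) p. 39 (pull-back of coverings)
[cite: MochizukiSemiAnbd2006, Def. 2.1 p.24]; Mochizuki, *Inter-universal Teichmüller theory I*, §2 p. 44 (the
decomposition groups `Π^tp_ℍ` read after "omission of some of the cuspidal edges": a statement about `𝒢_ℍ` moved
across the cusp omission `𝒢 ⊇ 𝒢|_{max}`) [cite: Mochizuki2012, IUTchI §2 p.44].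

abc-iut cell, layer L3, seat abc-iut-L3-d1 gen 12 (row «AUTOFCONJ-INDUCES-UPTOTWIST + HHSTAB-DERIVED@FINITE-SPECIAL-
FIBRE», stage 2 brick; L3-lead δ1 (4)).  The TEMPERED (`ProfiniteSemiGraph` / `B^cov` / `B^temp`) twin of the
profinite bookkeeping `NestedRestriction.lean` (`SemiGraph.Subgraph.restrictTo K H` = `K ∩ H ⊆ H`,
`SemiGraphOfAnabelioids.restrictToComparison`).  For two sub-semi-graphs `K, H ⊆ 𝔾` the doubly restricted
presentations `(𝒢|_H)|_{K ∩ H}` and `(𝒢|_K)|_{H ∩ K}` are the SAME semi-graph of anabelioids up to the relabelling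
`⟨⟨v, v ∈ H⟩, v ∈ K⟩ ↔ ⟨⟨v, v ∈ K⟩, v ∈ H⟩` of their index types:

* `SemiGraph.Subgraph.restrictToSwap K H : (K ∩ H ⊆ H).toSemiGraph ⟶ (H ∩ K ⊆ K).toSemiGraph` — the relabelling
  isomorphism of underlying semi-graphs (`restrictToSwap_comp`: its inverse is `restrictToSwap H K`;
  `isIso_restrictToSwap`);
* `ProfiniteSemiGraph.restrictToSwapHom 𝒢 K H : Hom ((𝒢|_H)|_{K∩H}) ((𝒢|_K)|_{H∩K})` — the relabelling as a
  morphism of profinite presentations: IDENTITY constituent homomorphisms, branch squares commuting on the nose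
  (`restrictToSwapConjugators`: the trivial family of 2-cells `θ_b = 1`); locally trivial with an isomorphism of
  underlying semi-graphs (`restrictToSwapHom_isLocallyTrivial`, `isIso_restrictToSwapHom_base`) — so
  abc-iut-L3-d6's `Hom.btempPullbackEquiv` applies: `B^temp((𝒢|_K)|_{H∩K}) ≌ B^temp((𝒢|_H)|_{K∩H})`;
* ★ `ProfiniteSemiGraph.covRestrictToSwapIso` : `(−)|_K ⋙ (−)|_{H∩K} ⋙ (swap)^*_1 ≅ (−)|_H ⋙ (−)|_{K∩H}` as
  functors `B^cov(𝒢) ⥤ B^cov((𝒢|_H)|_{K∩H})` with IDENTITY components (same fibres `S_v`, `S_e`, same gluings),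
  and its `B^temp` form `btempRestrictToSwapIso`.

Use (the proof-only sequel `SpecialFibreDecompSubgroupsCuspOmission.lean`): with `K := ℍ ⊆ 𝔾^c` and `H :=` the
maximal subgraph (cusp omission), `B^temp(𝒢^c|_ℍ) ≌ B^temp((𝒢^c|_ℍ)|_{max ∩ ℍ}) ≌ B^temp(𝒢|_{ℍ ∩ max})`
compatibly with the restrictions from `B^temp(𝒢^c)` — the decomposition subgroups of `ℍ` in `π₁^temp(𝒢^c)` are
those of `ℍ ∩ 𝒢` in `π₁^temp(𝒢)`.  Definitions + definitional bookkeeping (review lane: this file declares `def`s);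
no instance, no notation, no `Prop` fact; nothing of the papers is asserted; nothing here bears on [IUTchIII]
Cor. 3.12 or asserts that abc is proved or refuted.
-/

noncomputable section

namespace Literature.AnabelianGeometry.SemiGraphs

open CategoryTheory

universe u

/-! ### Semi-graphs: the relabelling `(K ∩ H ⊆ H) ≅ (H ∩ K ⊆ K)` -/

namespace SemiGraph.Subgraph

variable {G : SemiGraph.{u}} (K H : G.Subgraph)

/-- The relabelling morphism of semi-graphs `(K ∩ H ⊆ H).toSemiGraph ⟶ (H ∩ K ⊆ K).toSemiGraph`:
`⟨⟨v, v ∈ H⟩, v ∈ K⟩ ↦ ⟨⟨v, v ∈ K⟩, v ∈ H⟩` on vertices, edges and branches (§1 p. 12: both are the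
sub-semi-graph `K ∩ H` of `G`). [cite: MochizukiSemiAnbd2006, §1 p.12] -/
def restrictToSwap : (K.restrictTo H).toSemiGraph ⟶ (H.restrictTo K).toSemiGraph where
  vertexMap v := ⟨⟨v.1.1, v.2⟩, v.1.2⟩
  edgeMap e := ⟨⟨e.1.1, e.2⟩, e.1.2⟩
  branchMap b := ⟨⟨b.1.1, b.2⟩, b.1.2⟩
  edgeOf_branchMap _ := rfl
  branchMap_injOn _ _ _ h := Subtype.ext (Subtype.ext (congrArg (fun c => c.1.1) h))
  abuts_branchMap b v h :=
    ((H.restrictTo K).abuts_eq_some_iff _ _).mpr ((K.abuts_eq_some_iff _ _).mpr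
      ((H.abuts_eq_some_iff _ _).mp (((K.restrictTo H).abuts_eq_some_iff b v).mp h)))

/-- The relabelling on vertices (definitional). [cite: MochizukiSemiAnbd2006, §1 p.12] -/
@[simp] theorem restrictToSwap_vertexMap (v : (K.restrictTo H).toSemiGraph.Vertex) :
    (restrictToSwap K H).vertexMap v = ⟨⟨v.1.1, v.2⟩, v.1.2⟩ := rfl

/-- The relabelling on edges (definitional). [cite: MochizukiSemiAnbd2006, §1 p.12] -/
@[simp] theorem restrictToSwap_edgeMap (e : (K.restrictTo H).toSemiGraph.Edge) :
    (restrictToSwap K H).edgeMap e = ⟨⟨e.1.1, e.2⟩, e.1.2⟩ := rfl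

/-- The relabelling on branches (definitional). [cite: MochizukiSemiAnbd2006, §1 p.12] -/
@[simp] theorem restrictToSwap_branchMap (b : (K.restrictTo H).toSemiGraph.Branch) :
    (restrictToSwap K H).branchMap b = ⟨⟨b.1.1, b.2⟩, b.1.2⟩ := rfl

/-- `swap_{K,H} ≫ swap_{H,K} = 𝟙`: the two relabellings are mutually inverse. [cite: MochizukiSemiAnbd2006, §1 p.12] -/
theorem restrictToSwap_comp : restrictToSwap K H ≫ restrictToSwap H K = 𝟙 (K.restrictTo H).toSemiGraph :=
  SemiGraph.hom_ext _ _ (funext fun _ => rfl) (funext fun _ => rfl) (funext fun _ => rfl)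

/-- The relabelling is an isomorphism of semi-graphs. [cite: MochizukiSemiAnbd2006, §1 p.12] -/
theorem isIso_restrictToSwap : IsIso (restrictToSwap K H) :=
  ⟨restrictToSwap H K, restrictToSwap_comp K H, restrictToSwap_comp H K⟩

end SemiGraph.Subgraph

/-! ### Profinite presentations: the relabelling as a morphism `(𝒢|_H)|_{K∩H} → (𝒢|_K)|_{H∩K}` -/

namespace ProfiniteSemiGraph

open Literature.AlgebraicGeometry.Frobenioids.QuasiTemperoid.BTempConnected (hom_ext_apply ρ_one_apply)

variable (𝒢 : ProfiniteSemiGraph.{u}) (K H : 𝒢.graph.Subgraph)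

/-- **The relabelling `(𝒢|_H)|_{K∩H} → (𝒢|_K)|_{H∩K}` as a morphism of profinite presentations**: over
`restrictToSwap K H`, with IDENTITY constituent homomorphisms (the constituents of both at `v` are `Π_v`,
"`(𝒢_ℍ)_c := 𝒢_c`", Def. 2.1 p. 24) and branch squares commuting on the nose. [cite: MochizukiSemiAnbd2006, Def. 2.1 p.24] -/
def restrictToSwapHom : Hom ((𝒢.restrict H).restrict (K.restrictTo H)) ((𝒢.restrict K).restrict (H.restrictTo K)) where
  base := SemiGraph.Subgraph.restrictToSwap K H
  hV v := ContinuousMonoidHom.id _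
  hE e := ContinuousMonoidHom.id _
  comm b v h := ⟨1, fun x => by rw [one_mul, inv_one, mul_one]; rfl⟩

/-- The underlying morphism of semi-graphs of the relabelling (definitional). [cite: MochizukiSemiAnbd2006, Def. 2.1 p.24] -/
theorem restrictToSwapHom_base : (𝒢.restrictToSwapHom K H).base = SemiGraph.Subgraph.restrictToSwap K H := rfl

/-- **The trivial family of 2-cells** of the relabelling: `θ_b = 1` for every branch.
[cite: MochizukiSemiAnbd2006, Rmk 2.4.2 p.26] -/
def restrictToSwapConjugators : (𝒢.restrictToSwapHom K H).ConjugatorFamily where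
  θ _ _ _ := 1
  spec b v h x := by
    rw [one_mul, inv_one, mul_one]
    rfl

/-- The trivial family, evaluated. [cite: MochizukiSemiAnbd2006, Rmk 2.4.2 p.26] -/
@[simp] theorem restrictToSwapConjugators_θ (b : ((𝒢.restrict H).restrict (K.restrictTo H)).graph.Branch)
    (v : ((𝒢.restrict H).restrict (K.restrictTo H)).graph.Vertex)
    (h : ((𝒢.restrict H).restrict (K.restrictTo H)).graph.abuts b = some v) :
    (𝒢.restrictToSwapConjugators K H).θ b v h = 1 := rfl

/-- The relabelling is locally trivial (identity constituents). [cite: MochizukiSemiAnbd2006, Def 2.2(ii) p.24] -/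
theorem restrictToSwapHom_isLocallyTrivial : (𝒢.restrictToSwapHom K H).IsLocallyTrivial :=
  ⟨fun _ => Function.bijective_id, fun _ => Function.bijective_id⟩

/-- The relabelling is an isomorphism on underlying semi-graphs. [cite: MochizukiSemiAnbd2006, §1 p.12] -/
theorem isIso_restrictToSwapHom_base : IsIso (C := SemiGraph.{u}) (𝒢.restrictToSwapHom K H).base :=
  SemiGraph.Subgraph.isIso_restrictToSwap K H

/-! ### `(−)|_K ⋙ (−)|_{H∩K} ⋙ swap^* ≅ (−)|_H ⋙ (−)|_{K∩H}` -/

/-- The two coverings `swap^*_1 ((S|_K)|_{H∩K})` and `(S|_H)|_{K∩H}` of `(𝒢|_H)|_{K∩H}` have the SAME gluing along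
every branch (elementwise: both are the gluing of `S` along the underlying branch of `𝔾`).
[cite: MochizukiSemiAnbd2006, Prop 3.6(iv) p.39] -/
theorem covRestrictToSwap_glue_apply (S : CovObj 𝒢) (b : ((𝒢.restrict H).restrict (K.restrictTo H)).graph.Branch)
    (v : ((𝒢.restrict H).restrict (K.restrictTo H)).graph.Vertex)
    (h : ((𝒢.restrict H).restrict (K.restrictTo H)).graph.abuts b = some v)
    (x : ((((𝒢.restrictToSwapHom K H).covPullbackWith (𝒢.restrictToSwapConjugators K H)).obj
      (((𝒢.restrict K).covRestrict (H.restrictTo K)).obj ((𝒢.covRestrict K).obj S))).SE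
        (((𝒢.restrict H).restrict (K.restrictTo H)).graph.edgeOf b)).obj.V) :
    ((((𝒢.restrictToSwapHom K H).covPullbackWith (𝒢.restrictToSwapConjugators K H)).obj
        (((𝒢.restrict K).covRestrict (H.restrictTo K)).obj ((𝒢.covRestrict K).obj S))).glue b v h).hom.hom.hom x =
      ((((𝒢.restrict H).covRestrict (K.restrictTo H)).obj ((𝒢.covRestrict H).obj S)).glue b v h).hom.hom.hom x := by
  rw [Hom.covPullbackWith_glue_apply_castPtE, restrictToSwapConjugators_θ, ρ_one_apply]
  rfl

/-- ★ **Nested restriction commutes with the relabelling**: `(−)|_K ⋙ (−)|_{H∩K} ⋙ swap^*_1 ≅ (−)|_H ⋙ (−)|_{K∩H}`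
as functors `B^cov(𝒢) ⥤ B^cov((𝒢|_H)|_{K∩H})`, with IDENTITY components ("`(𝒢_ℍ)_c := 𝒢_c`": restricting in
either order gives the same fibres and the same gluings). [cite: MochizukiSemiAnbd2006, Def. 2.1 p.24] -/
def covRestrictToSwapIso :
    𝒢.covRestrict K ⋙ (𝒢.restrict K).covRestrict (H.restrictTo K) ⋙
        (𝒢.restrictToSwapHom K H).covPullbackWith (𝒢.restrictToSwapConjugators K H) ≅
      𝒢.covRestrict H ⋙ (𝒢.restrict H).covRestrict (K.restrictTo H) :=
  NatIso.ofComponents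
    (fun S => CovObj.isoOfComponents
      (fun v => BTemp.isoOfEquiv (Equiv.refl _) fun _ _ => rfl)
      (fun e => BTemp.isoOfEquiv (Equiv.refl _) fun _ _ => rfl)
      (fun b v h => hom_ext_apply fun x => by
        change ((((𝒢.restrict H).covRestrict (K.restrictTo H)).obj ((𝒢.covRestrict H).obj S)).glue b v h).hom.hom.hom x =
          ((((𝒢.restrictToSwapHom K H).covPullbackWith (𝒢.restrictToSwapConjugators K H)).obj
            (((𝒢.restrict K).covRestrict (H.restrictTo K)).obj ((𝒢.covRestrict K).obj S))).glue b v h).hom.hom.hom x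
        rw [covRestrictToSwap_glue_apply]))
    (fun f => by
      refine CovHom.ext (funext fun v => ?_) (funext fun e => ?_) <;> exact hom_ext_apply fun _ => rfl)

/-- The components of `covRestrictToSwapIso` are the identity on vertex fibres (definitional).
[cite: MochizukiSemiAnbd2006, Def. 2.1 p.24] -/
@[simp] theorem covRestrictToSwapIso_hom_app_fV_apply (S : CovObj 𝒢)
    (v : ((𝒢.restrict H).restrict (K.restrictTo H)).graph.Vertex)
    (x : ((((𝒢.restrictToSwapHom K H).covPullbackWith (𝒢.restrictToSwapConjugators K H)).obj
      (((𝒢.restrict K).covRestrict (H.restrictTo K)).obj ((𝒢.covRestrict K).obj S))).SV v).obj.V) :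
    ((((𝒢.covRestrictToSwapIso K H).hom.app S).fV v).hom.hom x : (S.SV v.1.1).obj.V) = x := rfl

/-- … and on edge fibres (definitional). [cite: MochizukiSemiAnbd2006, Def. 2.1 p.24] -/
@[simp] theorem covRestrictToSwapIso_hom_app_fE_apply (S : CovObj 𝒢)
    (e : ((𝒢.restrict H).restrict (K.restrictTo H)).graph.Edge)
    (x : ((((𝒢.restrictToSwapHom K H).covPullbackWith (𝒢.restrictToSwapConjugators K H)).obj
      (((𝒢.restrict K).covRestrict (H.restrictTo K)).obj ((𝒢.covRestrict K).obj S))).SE e).obj.V) :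
    ((((𝒢.covRestrictToSwapIso K H).hom.app S).fE e).hom.hom x : (S.SE e.1.1).obj.V) = x := rfl

/-- ★ **The `B^temp` form**: `(−)|_K ⋙ (−)|_{H∩K} ⋙ swap^*_1 ≅ (−)|_H ⋙ (−)|_{K∩H}` as functors
`B^temp(𝒢) ⥤ B^temp((𝒢|_H)|_{K∩H})`. [cite: MochizukiSemiAnbd2006, Def 3.5(ii) p.37] -/
def btempRestrictToSwapIso :
    𝒢.btempRestrict K ⋙ (𝒢.restrict K).btempRestrict (H.restrictTo K) ⋙
        (𝒢.restrictToSwapHom K H).btempPullbackWith (𝒢.restrictToSwapConjugators K H) ≅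
      𝒢.btempRestrict H ⋙ (𝒢.restrict H).btempRestrict (K.restrictTo H) :=
  NatIso.ofComponents (fun S => ObjectProperty.isoMk _ ((𝒢.covRestrictToSwapIso K H).app S.obj))
    (fun f => ObjectProperty.hom_ext _ ((𝒢.covRestrictToSwapIso K H).hom.naturality f.hom))

/-- **`B^temp((𝒢|_K)|_{H∩K}) ≌ B^temp((𝒢|_H)|_{K∩H})`**: pull-back along the relabelling is an equivalence of
categories (abc-iut-L3-d6's `Hom.btempPullbackEquiv` for a locally trivial morphism with an isomorphism of underlying
semi-graphs). [cite: MochizukiSemiAnbd2006, Prop 3.6(iv) p.39] -/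
def btempRestrictToSwapEquiv :
    BTempCat ((𝒢.restrict K).restrict (H.restrictTo K)) ≌ BTempCat ((𝒢.restrict H).restrict (K.restrictTo H)) :=
  haveI := 𝒢.isIso_restrictToSwapHom_base K H
  (𝒢.restrictToSwapHom K H).btempPullbackEquiv (𝒢.restrictToSwapHom_isLocallyTrivial K H)
    (𝒢.restrictToSwapConjugators K H)

/-- The functor of the equivalence IS the pull-back `swap^*_1` (definitional). [cite: MochizukiSemiAnbd2006, Prop 3.6(iv) p.39] -/
theorem btempRestrictToSwapEquiv_functor :
    (𝒢.btempRestrictToSwapEquiv K H).functor =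
      (𝒢.restrictToSwapHom K H).btempPullbackWith (𝒢.restrictToSwapConjugators K H) := rfl

end ProfiniteSemiGraph

end Literature.AnabelianGeometry.SemiGraphs

end
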